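import Summits.NavierStokesRegularity.NavierStokesRegularity.Theorems.PalasekTowerBreakdownEpisodeBaseStrainPairingStretching

/-!
# Strain-currency pairing lemmas, Part III: Green's identity for two fields, the two-field stretching
# identity, and the level-2 (`H²`) TRANSPORT term

Cell `ns-blowup`, seat `ns-palasek-19179-p2` (g6; holder-of-record lineage of crux
stmt-NavierStokesRegularity-19179 `EpisodeBase`, route `PalasekTowerBreakdown`; `--supports
stmt-NavierStokesRegularity-19179`). Sequel of Parts I/II (`…StrainPairing.lean`, `…StrainPairingStretching.lean`:
levels 0 and 1) for the stub `stub_strain_door : StrainDoor` of the strategist line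
`Cruxes/EpisodeBase/Lines/straindoor.lean` (cstrat-19179, v2), whose weighted functional
`E_κ = ‖w̃‖² + κ²‖∇w̃‖² + κ⁴‖D²w̃‖²` needs the SECOND-derivative level. LABEL: E–C analysis (KERNEL: theorems only;
no definition, no named fact, no `sorry`; register-free — any finite-dimensional real inner product space `E`).
WHAT THIS IS NOT: not Navier–Stokes evidence — whole-space calculus identities and bounds for two given fields;
no flow, run, design or blow-up is exhibited or asserted.

## What is proved (`u : E → E` the reference with bounded derivatives, `v` a smooth `L²` field, `b` the standard
orthonormal basis, `∂ₖ g := Dg(·) bₖ`, `H(v) := ∑ₗ ∑ₖ ∫ ‖∂ₖ∂ₗ v‖²` the Hessian energy)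

* `integral_inner_laplacian_eq_neg_sum` — Green's identity for two smooth `L²` fields:
  `∫ ⟪F, ΔG⟫ = −∑ₖ ∫ ⟪∂ₖF, ∂ₖG⟫`.
* `integral_inner_convect_laplacian_eq_two_field` — the two-field stretching identity
  `∫ ⟪(a·∇)w, ΔG⟫ = −∑ₖ ∫ ⟪Dw(∂ₖa), ∂ₖG⟫ − ∑ₖ ∫ ⟪(D²w bₖ)(a), ∂ₖG⟫` (`w` bounded derivatives, `a, G` smooth `L²`).
* `fderiv_fderiv_apply_comm` — `∂ₖ∂ₗ v = ∂ₗ∂ₖ v` for `C²` fields, in `fderiv` form.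
* **`abs_sum_integral_inner_fderiv_convect_laplacian_le`** (level 2, TRANSPORT, `div u = 0`):
  `|∑ₗ ∫ ⟪∂ₗ[(u·∇)v], Δ(∂ₗv)⟫| ≤ 2σ H(v) + σ₂ ∫ ‖Dv‖ ∑ₗ∑ₖ ‖∂ₖ∂ₗv‖` under the strain majorant
  `|⟪Du(x)ξ, ξ⟫| ≤ σ‖ξ‖²` and `‖D²u‖ ≤ σ₂` — TWO strain units (one from transporting `∂ₗ v` by `u`: level 1 applied
  to `∂ₗ v`; one from the trace pairing `∑ₗ ⟪D(∂ₖv)(Du bₗ), D(∂ₖv) bₗ⟫`), no `‖u‖_∞`, no `‖Du‖_∞`.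
With Parts I/II and the level-2 stretching term (Part IV) the pure-strain coefficients of `d/dt E_κ` are
`2σ, 4σ, 6σ` at the three levels (the card's rate `6σ + …`), all cross terms carrying `σ₂`, `σ₃` only.

References: P. Constantin, C. Foias, *Navier–Stokes Equations*, 1988, Ch. 10 [cite: ConstantinFoiasNSE1988, Ch. 10 Thm. 10.2];
C. R. Doering, J. D. Gibbon, *Applied Analysis of the Navier–Stokes Equations*, CUP 1995, §2.3
[cite: DoeringGibbon1995, §2.3 (2.3.29)–(2.3.31)].
-/

noncomputable section

set_option linter.dupNamespace false

open MeasureTheory Filter Function Set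
open scoped ENNReal NNReal RealInnerProductSpace Topology Laplacian
open Literature.Analysis.FunctionSpaces Literature.Analysis.FluidPDE

namespace Summit.NavierStokesRegularity.NavierStokesRegularity.Theorems.StrainPairing

variable {E : Type*} [NormedAddCommGroup E] [InnerProductSpace ℝ E] [FiniteDimensional ℝ E]
  [MeasurableSpace E] [BorelSpace E]
variable {E' : Type*} [NormedAddCommGroup E'] [InnerProductSpace ℝ E'] [FiniteDimensional ℝ E']

/-! ## Green's identity for two smooth `L²` fields and the two-field stretching identity -/

section TwoField

omit [FiniteDimensional ℝ E'] in
/-- **Green's identity for two smooth `L²` fields**: `∫ ⟪F, ΔG⟫ = −∑ₖ ∫ ⟪∂ₖF, ∂ₖG⟫` (no boundary terms on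
the whole space; all pairings are in `L¹`). [cite: ConstantinFoiasNSE1988, Ch. 10 Thm. 10.2] -/
theorem integral_inner_laplacian_eq_neg_sum {F G : E → E'} (hF : IsSmoothL2Field F) (hG : IsSmoothL2Field G) :
    ∫ x, ⟪F x, (Δ G) x⟫ =
      -∑ k, ∫ x, ⟪fderiv ℝ F x (stdOrthonormalBasis ℝ E k), fderiv ℝ G x (stdOrthonormalBasis ℝ E k)⟫ := by
  set b := stdOrthonormalBasis ℝ E with hb
  have hG2 : ContDiff ℝ 2 G := hG.contDiff_nat 2
  have hrep : ∀ x, ⟪F x, (Δ G) x⟫ = ∑ k, ⟪F x, fderiv ℝ (fun y => fderiv ℝ G y (b k)) x (b k)⟫ := by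
    intro x
    rw [laplacian_eq_sum_fderiv_fderiv b hG2 x, inner_sum]
  simp_rw [hrep]
  rw [integral_finsetSum _ fun k _ => ?_]
  · rw [← Finset.sum_neg_distrib]
    refine Finset.sum_congr rfl fun k _ => ?_
    have hGk : IsSmoothL2Field (fun y => fderiv ℝ G y (b k)) := hG.fderiv_apply (b k)
    exact integral_inner_fderiv_apply_eq_neg (hF.contDiff_nat 1) (hGk.contDiff_nat 1) (b k)
      (integrable_inner_of_memLp_two (hF.memLp_fderiv_apply (b k)) hGk.memLp_two)
      (integrable_inner_of_memLp_two hF.memLp_two (hGk.memLp_fderiv_apply (b k)))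
      (integrable_inner_of_memLp_two hF.memLp_two hGk.memLp_two)
  · exact integrable_inner_of_memLp_two hF.memLp_two ((hG.fderiv_apply (b k)).memLp_fderiv_apply (b k))

/-- **Two-field stretching identity.** For `w : E → E'` with bounded derivatives and smooth `L²` fields
`a : E → E`, `G : E → E'`: `∫ ⟪(a·∇)w, ΔG⟫ = −∑ₖ ∫ ⟪Dw(∂ₖa), ∂ₖG⟫ − ∑ₖ ∫ ⟪(D²w bₖ)(a), ∂ₖG⟫`
(one integration by parts per coordinate; `∂ₖ[(a·∇)w] = Dw(∂ₖa) + (D²w bₖ)(a)`).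
[cite: ConstantinFoiasNSE1988, Ch. 10 Thm. 10.2] -/
theorem integral_inner_convect_laplacian_eq_two_field {w : E → E'} {a : E → E} {G : E → E'}
    (hw : HasBoundedDerivs w) (ha : IsSmoothL2Field a) (hG : IsSmoothL2Field G) :
    ∫ x, ⟪convect a w x, (Δ G) x⟫ =
      -(∑ k, ∫ x, ⟪fderiv ℝ w x (fderiv ℝ a x (stdOrthonormalBasis ℝ E k)),
          fderiv ℝ G x (stdOrthonormalBasis ℝ E k)⟫) -
        ∑ k, ∫ x, ⟪fderiv ℝ (fderiv ℝ w) x (stdOrthonormalBasis ℝ E k) (a x),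
          fderiv ℝ G x (stdOrthonormalBasis ℝ E k)⟫ := by
  set b := stdOrthonormalBasis ℝ E with hb
  obtain ⟨M₁, hM₁⟩ := hw.exists_norm_fderiv_le
  obtain ⟨M₂, hM₂⟩ := hw.fderiv.exists_norm_fderiv_le
  have hw1 : ContDiff ℝ 1 w := hw.contDiff_nat 1
  have hw2 : ContDiff ℝ 2 w := hw.contDiff_nat 2
  have ha1 : ContDiff ℝ 1 a := ha.contDiff_nat 1
  have hG2 : ContDiff ℝ 2 G := hG.contDiff_nat 2
  -- the field `F = (a·∇)w = Dw(a)` is `C¹`, in `L²`, with `∂ₖF ∈ L²`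
  set F : E → E' := convect a w with hF
  have hFdef : F = fun y => (fderiv ℝ w y) (a y) := by funext y; rfl
  have hF1 : ContDiff ℝ 1 F := by
    rw [hFdef]; exact (hw2.fderiv_right (m := 1) le_rfl).clm_apply ha1
  have hFm : MemLp F 2 volume := by
    refine MemLp.of_le_mul (c := M₁) ha.memLp_two hF1.continuous.aestronglyMeasurable
      (Eventually.of_forall fun x => ?_)
    rw [hFdef]
    exact (ContinuousLinearMap.le_opNorm _ _).trans (mul_le_mul_of_nonneg_right (hM₁ x) (norm_nonneg _))
  have hdF : ∀ k x, fderiv ℝ F x (b k) =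
      fderiv ℝ w x (fderiv ℝ a x (b k)) + fderiv ℝ (fderiv ℝ w) x (b k) (a x) := by
    intro k x
    have hdw : DifferentiableAt ℝ (fderiv ℝ w) x :=
      ((hw2.fderiv_right (m := 1) le_rfl).differentiable one_ne_zero) x
    have hda : DifferentiableAt ℝ a x := (ha1.differentiable one_ne_zero) x
    rw [hFdef, fderiv_clm_apply hdw hda]
    simp only [add_apply, ContinuousLinearMap.coe_comp, Function.comp_apply,
      ContinuousLinearMap.flip_apply]
  have hT1m : ∀ k, MemLp (fun x => fderiv ℝ w x (fderiv ℝ a x (b k))) 2 volume := by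
    intro k
    refine MemLp.of_le_mul (c := M₁) ((ha.fderiv_apply (b k)).memLp_two) ?_
      (Eventually.of_forall fun x => ?_)
    · exact ((hw1.continuous_fderiv one_ne_zero).clm_apply
        ((ha1.continuous_fderiv one_ne_zero).clm_apply continuous_const)).aestronglyMeasurable
    · exact (ContinuousLinearMap.le_opNorm _ _).trans
        (mul_le_mul_of_nonneg_right (hM₁ x) (norm_nonneg _))
  have hT2m : ∀ k, MemLp (fun x => fderiv ℝ (fderiv ℝ w) x (b k) (a x)) 2 volume := by
    intro k
    refine MemLp.of_le_mul (c := M₂) ha.memLp_two ?_ (Eventually.of_forall fun x => ?_)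
    · exact ((((hw2.fderiv_right (m := 1) le_rfl).continuous_fderiv one_ne_zero).clm_apply
        continuous_const).clm_apply ha.continuous).aestronglyMeasurable
    · calc ‖fderiv ℝ (fderiv ℝ w) x (b k) (a x)‖ ≤ ‖fderiv ℝ (fderiv ℝ w) x (b k)‖ * ‖a x‖ :=
          ContinuousLinearMap.le_opNorm _ _
        _ ≤ ‖fderiv ℝ (fderiv ℝ w) x‖ * ‖b k‖ * ‖a x‖ := by
          gcongr; exact ContinuousLinearMap.le_opNorm _ _
        _ ≤ M₂ * ‖a x‖ := by
          rw [b.orthonormal.1 k, mul_one]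
          exact mul_le_mul_of_nonneg_right (hM₂ x) (norm_nonneg _)
  -- the `k`-th term
  have hk : ∀ k, ∫ x, ⟪F x, fderiv ℝ (fun y => fderiv ℝ G y (b k)) x (b k)⟫ =
      -(∫ x, ⟪fderiv ℝ w x (fderiv ℝ a x (b k)), fderiv ℝ G x (b k)⟫) -
        ∫ x, ⟪fderiv ℝ (fderiv ℝ w) x (b k) (a x), fderiv ℝ G x (b k)⟫ := by
    intro k
    set Gk : E → E' := fun y => fderiv ℝ G y (b k) with hGk
    have hGS : IsSmoothL2Field Gk := hG.fderiv_apply (b k)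
    have hdFm : MemLp (fun x => fderiv ℝ F x (b k)) 2 volume := by
      have : (fun x => fderiv ℝ F x (b k)) =
          (fun x => fderiv ℝ w x (fderiv ℝ a x (b k))) + fun x => fderiv ℝ (fderiv ℝ w) x (b k) (a x) := by
        funext x; simp only [Pi.add_apply, hdF]
      rw [this]; exact (hT1m k).add (hT2m k)
    have h₁ : Integrable (fun x => ⟪fderiv ℝ F x (b k), Gk x⟫) volume :=
      integrable_inner_of_memLp_two hdFm hGS.memLp_two
    have h₂ : Integrable (fun x => ⟪F x, fderiv ℝ Gk x (b k)⟫) volume :=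
      integrable_inner_of_memLp_two hFm (hGS.memLp_fderiv_apply (b k))
    have h₃ : Integrable (fun x => ⟪F x, Gk x⟫) volume := integrable_inner_of_memLp_two hFm hGS.memLp_two
    rw [integral_inner_fderiv_apply_eq_neg hF1 (hGS.contDiff_nat 1) (b k) h₁ h₂ h₃]
    simp_rw [hdF, inner_add_left]
    rw [integral_add (integrable_inner_of_memLp_two (hT1m k) hGS.memLp_two)
      (integrable_inner_of_memLp_two (hT2m k) hGS.memLp_two), neg_add', hGk]
  have hrep : ∀ x, ⟪F x, (Δ G) x⟫ = ∑ k, ⟪F x, fderiv ℝ (fun y => fderiv ℝ G y (b k)) x (b k)⟫ := by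
    intro x
    rw [laplacian_eq_sum_fderiv_fderiv b hG2 x, inner_sum]
  simp_rw [hrep]
  rw [integral_finsetSum _ fun k _ => ?_]
  · simp_rw [hk]
    rw [Finset.sum_sub_distrib, Finset.sum_neg_distrib]
  · exact integrable_inner_of_memLp_two hFm ((hG.fderiv_apply (b k)).memLp_fderiv_apply (b k))

omit [FiniteDimensional ℝ E] [FiniteDimensional ℝ E'] [MeasurableSpace E] [BorelSpace E] in
/-- **Mixed partials commute** (`fderiv` form): `∂_w (∂_m v) = ∂_m (∂_w v)` for a `C²` field.
[cite: ConstantinFoiasNSE1988, Ch. 10 Thm. 10.2] -/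
theorem fderiv_fderiv_apply_comm {v : E → E'} (hv : ContDiff ℝ 2 v) (x m w : E) :
    fderiv ℝ (fun y => fderiv ℝ v y m) x w = fderiv ℝ (fun y => fderiv ℝ v y w) x m := by
  have hdv : DifferentiableAt ℝ (fderiv ℝ v) x :=
    ((hv.fderiv_right (m := 1) le_rfl).differentiable one_ne_zero) x
  have hsymm : IsSymmSndFDerivAt ℝ v x := (hv.contDiffAt (x := x)).isSymmSndFDerivAt (by simp)
  rw [fderiv_clm_apply hdv (differentiableAt_const m), fderiv_clm_apply hdv (differentiableAt_const w)]
  simp only [fderiv_fun_const, Pi.zero_apply, ContinuousLinearMap.comp_zero, zero_add,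
    ContinuousLinearMap.flip_apply]
  exact hsymm w m

end TwoField

/-! ## Level 2: the transport term -/

section LevelTwoTransport

/-- **Level 2, transport BOUND in strain currency.** For a divergence-free reference `u` with bounded
derivatives, `|⟪Du(x)ξ, ξ⟫| ≤ σ‖ξ‖²`, `‖D²u(x)‖ ≤ σ₂`, and a smooth `L²` field `v`:
`|∑ₗ ∫ ⟪∂ₗ[(u·∇)v], Δ(∂ₗv)⟫| ≤ 2σ ∑ₗ∑ₖ ∫ ‖∂ₖ∂ₗv‖² + σ₂ ∫ ‖Dv‖ ∑ₗ∑ₖ ‖∂ₖ∂ₗv‖`.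
Proof: `∂ₗ[(u·∇)v] = (∂ₗu·∇)v + (u·∇)(∂ₗv)`; the second term is the level-1 transport of `∂ₗv` (Part I,
`≤ σ ∑ₖ ‖∂ₖ∂ₗv‖²`); the first is integrated by parts once more, `∂ₖ[(∂ₗu·∇)v] = Dv(D²u bₖ bₗ) + D(∂ₖv)(Du bₗ)`,
the Hessian piece is the `σ₂` cross term and `∑ₗ ⟪D(∂ₖv)(Du bₗ), D(∂ₖv) bₗ⟫` (mixed partials commute) is a trace
pairing seeing only `sym Du` (`abs_sum_inner_comp_le_of_quadForm_le`). [cite: ConstantinFoiasNSE1988, Ch. 10 Thm. 10.2]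
[cite: DoeringGibbon1995, §2.3 (2.3.29)–(2.3.31)] -/
theorem abs_sum_integral_inner_fderiv_convect_laplacian_le {u : E → E} {v : E → E'}
    (hu : HasBoundedDerivs u) (hdiv : VectorCalculus.IsDivFree u) (hv : IsSmoothL2Field v) {σ σ₂ : ℝ}
    (hσ : ∀ x ξ : E, |⟪fderiv ℝ u x ξ, ξ⟫| ≤ σ * ‖ξ‖ ^ 2)
    (hσ₂ : ∀ x, ‖fderiv ℝ (fderiv ℝ u) x‖ ≤ σ₂) :
    |∑ l, ∫ x, ⟪fderiv ℝ (convect u v) x (stdOrthonormalBasis ℝ E l),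
        (Δ (fun y => fderiv ℝ v y (stdOrthonormalBasis ℝ E l))) x⟫| ≤
      2 * σ * (∑ l, ∑ k, ∫ x, ‖fderiv ℝ (fun y => fderiv ℝ v y (stdOrthonormalBasis ℝ E l)) x
          (stdOrthonormalBasis ℝ E k)‖ ^ 2) +
        σ₂ * ∫ x, ‖fderiv ℝ v x‖ * ∑ l, ∑ k, ‖fderiv ℝ (fun y => fderiv ℝ v y (stdOrthonormalBasis ℝ E l)) x
          (stdOrthonormalBasis ℝ E k)‖ := by
  set b := stdOrthonormalBasis ℝ E with hb
  have hu1 : ContDiff ℝ 1 u := hu.contDiff_nat 1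
  have hu2 : ContDiff ℝ 2 u := hu.contDiff_nat 2
  have hv1 : ContDiff ℝ 1 v := hv.contDiff_nat 1
  have hv2 : ContDiff ℝ 2 v := hv.contDiff_nat 2
  have hσ₂0 : 0 ≤ σ₂ := le_trans (norm_nonneg (fderiv ℝ (fderiv ℝ u) 0)) (hσ₂ 0)
  -- the fields `Vₗ = ∂ₗ v` (smooth `L²`) and `Uₗ = ∂ₗ u` (bounded derivatives)
  set V : Fin (Module.finrank ℝ E) → E → E' := fun l y => fderiv ℝ v y (b l) with hV
  set U : Fin (Module.finrank ℝ E) → E → E := fun l y => fderiv ℝ u y (b l) with hU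
  have hVS : ∀ l, IsSmoothL2Field (V l) := fun l => hv.fderiv_apply (b l)
  have hUS : ∀ l, HasBoundedDerivs (U l) := fun l => hu.fderiv_apply (b l)
  have hUV : ∀ l, IsSmoothL2Field (convect (U l) v) := fun l => hv.convect (hUS l)
  have huV : ∀ l, IsSmoothL2Field (convect u (V l)) := fun l => (hVS l).convect hu
  -- `∂ₗ[(u·∇)v] = (Uₗ·∇)v + (u·∇)Vₗ`
  have hsplit : ∀ l x, fderiv ℝ (convect u v) x (b l) = convect (U l) v x + convect u (V l) x := by
    intro l x; rw [fderiv_convect_apply hu1 hv2 x (b l)]; rfl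
  -- the Hessian entries and the energy
  set H : ℝ := ∑ l, ∑ k, ∫ x, ‖fderiv ℝ (V l) x (b k)‖ ^ 2 with hH
  have hsq : ∀ l k, Integrable (fun x => ‖fderiv ℝ (V l) x (b k)‖ ^ 2) volume := by
    intro l k
    have := integrable_inner_of_memLp_two (((hVS l).fderiv_apply (b k)).memLp_two)
      (((hVS l).fderiv_apply (b k)).memLp_two)
    exact this.congr (Eventually.of_forall fun x => by simp only [real_inner_self_eq_norm_sq])
  -- TERM B: `∑ₗ ∫ ⟪(u·∇)Vₗ, ΔVₗ⟫`, level 1 applied to `Vₗ`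
  have hB : |∑ l, ∫ x, ⟪convect u (V l) x, (Δ (V l)) x⟫| ≤ σ * H := by
    rw [hH, Finset.mul_sum]
    refine (Finset.abs_sum_le_sum_abs _ _).trans (Finset.sum_le_sum fun l _ => ?_)
    exact abs_integral_inner_convect_laplacian_le_of_strain hu hdiv (hVS l) hσ
  -- TERM A: `∑ₗ ∫ ⟪(Uₗ·∇)v, ΔVₗ⟫ = −∑ₗ∑ₖ ∫ ⟪Dv(D Uₗ bₖ), ∂ₖVₗ⟫ − ∑ₗ∑ₖ ∫ ⟪DVₖ(Du bₗ), DVₖ bₗ⟫`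
  have hA_id : ∀ l, ∫ x, ⟪convect (U l) v x, (Δ (V l)) x⟫ =
      -∑ k, ∫ x, ⟪fderiv ℝ (convect (U l) v) x (b k), fderiv ℝ (V l) x (b k)⟫ :=
    fun l => integral_inner_laplacian_eq_neg_sum (hUV l) (hVS l)
  have hdA : ∀ l k x, fderiv ℝ (convect (U l) v) x (b k) =
      fderiv ℝ v x (fderiv ℝ (U l) x (b k)) + fderiv ℝ (V k) x (U l x) := by
    intro l k x; rw [fderiv_convect_apply ((hUS l).contDiff_nat 1) hv2 x (b k)]
  have hcomm : ∀ l k x, fderiv ℝ (V l) x (b k) = fderiv ℝ (V k) x (b l) :=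
    fun l k x => fderiv_fderiv_apply_comm hv2 x (b l) (b k)
  obtain ⟨M₂, hM₂⟩ := hu.fderiv.exists_norm_fderiv_le
  obtain ⟨M₁, hM₁⟩ := hu.exists_norm_fderiv_le
  have hUlk : ∀ l k x, ‖fderiv ℝ (U l) x (b k)‖ ≤ σ₂ := by
    intro l k x
    have h1 : fderiv ℝ (U l) x (b k) = fderiv ℝ (fderiv ℝ u) x (b k) (b l) := by
      have hdu : DifferentiableAt ℝ (fderiv ℝ u) x :=
        ((hu2.fderiv_right (m := 1) le_rfl).differentiable one_ne_zero) x
      rw [hU]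
      simp only
      rw [fderiv_clm_apply hdu (differentiableAt_const (b l))]
      simp only [fderiv_fun_const, Pi.zero_apply, ContinuousLinearMap.comp_zero, zero_add,
        ContinuousLinearMap.flip_apply]
    rw [h1]
    calc ‖fderiv ℝ (fderiv ℝ u) x (b k) (b l)‖ ≤ ‖fderiv ℝ (fderiv ℝ u) x (b k)‖ * ‖b l‖ :=
          ContinuousLinearMap.le_opNorm _ _
      _ ≤ ‖fderiv ℝ (fderiv ℝ u) x‖ * ‖b k‖ * ‖b l‖ := by gcongr; exact ContinuousLinearMap.le_opNorm _ _
      _ ≤ σ₂ := by rw [b.orthonormal.1 k, b.orthonormal.1 l, mul_one, mul_one]; exact hσ₂ x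
  -- integrability of the two families of summands
  have hi1 : ∀ l k, Integrable (fun x => ⟪fderiv ℝ v x (fderiv ℝ (U l) x (b k)), fderiv ℝ (V l) x (b k)⟫) volume := by
    intro l k
    have hm : MemLp (fun x => fderiv ℝ v x (fderiv ℝ (U l) x (b k))) 2 volume := by
      refine MemLp.of_le_mul (c := σ₂) (memLp_fderiv_two hv) ?_ (Eventually.of_forall fun x => ?_)
      · exact ((hv2.continuous_fderiv (by norm_num)).clm_apply
          ((((hUS l).contDiff_nat 1).continuous_fderiv one_ne_zero).clm_apply continuous_const)).aestronglyMeasurable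
      · calc ‖fderiv ℝ v x (fderiv ℝ (U l) x (b k))‖ ≤ ‖fderiv ℝ v x‖ * ‖fderiv ℝ (U l) x (b k)‖ :=
            ContinuousLinearMap.le_opNorm _ _
          _ ≤ σ₂ * ‖fderiv ℝ v x‖ := by
            rw [mul_comm]; exact mul_le_mul_of_nonneg_right (hUlk l k x) (norm_nonneg _)
    exact integrable_inner_of_memLp_two hm (((hVS l).fderiv_apply (b k)).memLp_two)
  have hi2 : ∀ l k, Integrable (fun x => ⟪fderiv ℝ (V k) x (U l x), fderiv ℝ (V l) x (b k)⟫) volume := by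
    intro l k
    have hm : MemLp (fun x => fderiv ℝ (V k) x (U l x)) 2 volume := by
      refine MemLp.of_le_mul (c := M₁) (memLp_fderiv_two (hVS k)) ?_ (Eventually.of_forall fun x => ?_)
      · exact ((((hVS k).contDiff_nat 1).continuous_fderiv one_ne_zero).clm_apply
          (hUS l).continuous).aestronglyMeasurable
      · calc ‖fderiv ℝ (V k) x (U l x)‖ ≤ ‖fderiv ℝ (V k) x‖ * ‖U l x‖ := ContinuousLinearMap.le_opNorm _ _
          _ ≤ ‖fderiv ℝ (V k) x‖ * (‖fderiv ℝ u x‖ * ‖b l‖) := by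
            gcongr; exact ContinuousLinearMap.le_opNorm _ _
          _ ≤ M₁ * ‖fderiv ℝ (V k) x‖ := by
            rw [b.orthonormal.1 l, mul_one, mul_comm]
            exact mul_le_mul_of_nonneg_right (hM₁ x) (norm_nonneg _)
    exact integrable_inner_of_memLp_two hm (((hVS l).fderiv_apply (b k)).memLp_two)
  have hA : ∑ l, ∫ x, ⟪convect (U l) v x, (Δ (V l)) x⟫ =
      -(∑ l, ∑ k, ∫ x, ⟪fderiv ℝ v x (fderiv ℝ (U l) x (b k)), fderiv ℝ (V l) x (b k)⟫) -
        ∑ l, ∑ k, ∫ x, ⟪fderiv ℝ (V k) x (U l x), fderiv ℝ (V l) x (b k)⟫ := by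
    have hl : ∀ l, ∫ x, ⟪convect (U l) v x, (Δ (V l)) x⟫ =
        -(∑ k, ∫ x, ⟪fderiv ℝ v x (fderiv ℝ (U l) x (b k)), fderiv ℝ (V l) x (b k)⟫) -
          ∑ k, ∫ x, ⟪fderiv ℝ (V k) x (U l x), fderiv ℝ (V l) x (b k)⟫ := by
      intro l
      rw [hA_id l]
      have hk' : ∀ k, ∫ x, ⟪fderiv ℝ (convect (U l) v) x (b k), fderiv ℝ (V l) x (b k)⟫ =
          (∫ x, ⟪fderiv ℝ v x (fderiv ℝ (U l) x (b k)), fderiv ℝ (V l) x (b k)⟫) +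
            ∫ x, ⟪fderiv ℝ (V k) x (U l x), fderiv ℝ (V l) x (b k)⟫ := by
        intro k
        simp_rw [hdA l k, inner_add_left]
        exact integral_add (hi1 l k) (hi2 l k)
      simp_rw [hk']
      rw [Finset.sum_add_distrib]
      ring
    simp_rw [hl]
    rw [Finset.sum_sub_distrib, Finset.sum_neg_distrib]
  -- bound of the Hessian cross term
  have hcross : ∀ l k, Integrable (fun x => ‖fderiv ℝ v x‖ * ‖fderiv ℝ (V l) x (b k)‖) volume := by
    intro l k
    exact (memLp_fderiv_two hv).norm.integrable_mul (((hVS l).fderiv_apply (b k)).memLp_two.norm)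
  have hA1 : |∑ l, ∑ k, ∫ x, ⟪fderiv ℝ v x (fderiv ℝ (U l) x (b k)), fderiv ℝ (V l) x (b k)⟫| ≤
      σ₂ * ∫ x, ‖fderiv ℝ v x‖ * ∑ l, ∑ k, ‖fderiv ℝ (V l) x (b k)‖ := by
    have hrep : (fun x => ‖fderiv ℝ v x‖ * ∑ l, ∑ k, ‖fderiv ℝ (V l) x (b k)‖) =
        fun x => ∑ l, ∑ k, ‖fderiv ℝ v x‖ * ‖fderiv ℝ (V l) x (b k)‖ := by
      funext x; rw [Finset.mul_sum]; exact Finset.sum_congr rfl fun l _ => by rw [Finset.mul_sum]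
    rw [hrep, integral_finsetSum _ fun l _ => integrable_finsetSum _ fun k _ => hcross l k, Finset.mul_sum]
    refine (Finset.abs_sum_le_sum_abs _ _).trans (Finset.sum_le_sum fun l _ => ?_)
    rw [integral_finsetSum _ fun k _ => hcross l k, Finset.mul_sum]
    refine (Finset.abs_sum_le_sum_abs _ _).trans (Finset.sum_le_sum fun k _ => ?_)
    rw [← integral_const_mul]
    refine (abs_integral_le_integral_abs).trans
      (integral_mono_of_nonneg (Eventually.of_forall fun x => abs_nonneg _)
        ((hcross l k).const_mul σ₂) (Eventually.of_forall fun x => ?_))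
    calc |⟪fderiv ℝ v x (fderiv ℝ (U l) x (b k)), fderiv ℝ (V l) x (b k)⟫|
        ≤ ‖fderiv ℝ v x (fderiv ℝ (U l) x (b k))‖ * ‖fderiv ℝ (V l) x (b k)‖ := abs_real_inner_le_norm _ _
      _ ≤ (‖fderiv ℝ v x‖ * σ₂) * ‖fderiv ℝ (V l) x (b k)‖ := by
          gcongr
          exact (ContinuousLinearMap.le_opNorm _ _).trans (mul_le_mul_of_nonneg_left (hUlk l k x) (norm_nonneg _))
      _ = σ₂ * (‖fderiv ℝ v x‖ * ‖fderiv ℝ (V l) x (b k)‖) := by ring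
  -- bound of the trace pairing: swap the sums, mixed partials commute, then the linear-algebra lemma
  have hA2 : |∑ l, ∑ k, ∫ x, ⟪fderiv ℝ (V k) x (U l x), fderiv ℝ (V l) x (b k)⟫| ≤ σ * H := by
    have hrw : ∑ l, ∑ k, ∫ x, ⟪fderiv ℝ (V k) x (U l x), fderiv ℝ (V l) x (b k)⟫ =
        ∑ k, ∫ x, ∑ l, ⟪fderiv ℝ (V k) x (fderiv ℝ u x (b l)), fderiv ℝ (V k) x (b l)⟫ := by
      rw [Finset.sum_comm]
      refine Finset.sum_congr rfl fun k _ => ?_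
      rw [integral_finsetSum _ fun l _ => ?_]
      · refine Finset.sum_congr rfl fun l _ => integral_congr_ae (Eventually.of_forall fun x => ?_)
        simp only [hcomm l k x]
        rfl
      · have := hi2 l k
        simp_rw [hcomm l k] at this
        exact this
    have hHk : H = ∑ k, ∫ x, ∑ l, ‖fderiv ℝ (V k) x (b l)‖ ^ 2 := by
      rw [hH, Finset.sum_comm]
      refine Finset.sum_congr rfl fun k _ => ?_
      rw [integral_finsetSum _ fun l _ => ?_]
      · exact Finset.sum_congr rfl fun l _ => integral_congr_ae (Eventually.of_forall fun x => by
          simp only [hcomm l k x])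
      · have := hsq l k
        simp_rw [hcomm l k] at this
        exact this
    rw [hrw, hHk, Finset.mul_sum]
    refine (Finset.abs_sum_le_sum_abs _ _).trans (Finset.sum_le_sum fun k _ => ?_)
    have hsqk : ∀ l, Integrable (fun x => ‖fderiv ℝ (V k) x (b l)‖ ^ 2) volume := by
      intro l
      have := hsq l k
      simp_rw [hcomm l k] at this
      exact this
    rw [← integral_const_mul]
    refine (abs_integral_le_integral_abs).trans
      (integral_mono_of_nonneg (Eventually.of_forall fun x => abs_nonneg _)
        ((integrable_finsetSum _ fun l _ => hsqk l).const_mul σ) (Eventually.of_forall fun x => ?_))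
    exact abs_sum_inner_comp_le_of_quadForm_le b (fderiv ℝ u x) (fderiv ℝ (V k) x) (hσ x)
  -- assembly
  have hsum : ∑ l, ∫ x, ⟪fderiv ℝ (convect u v) x (b l), (Δ (V l)) x⟫ =
      (∑ l, ∫ x, ⟪convect (U l) v x, (Δ (V l)) x⟫) + ∑ l, ∫ x, ⟪convect u (V l) x, (Δ (V l)) x⟫ := by
    rw [← Finset.sum_add_distrib]
    refine Finset.sum_congr rfl fun l _ => ?_
    simp_rw [hsplit l, inner_add_left]
    exact integral_add (integrable_inner_of_memLp_two (hUV l).memLp_two (hVS l).laplacian.memLp_two)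
      (integrable_inner_of_memLp_two (huV l).memLp_two (hVS l).laplacian.memLp_two)
  rw [hsum, hA]
  set S₁ := ∑ l, ∑ k, ∫ x, ⟪fderiv ℝ v x (fderiv ℝ (U l) x (b k)), fderiv ℝ (V l) x (b k)⟫ with hS₁
  set S₂ := ∑ l, ∑ k, ∫ x, ⟪fderiv ℝ (V k) x (U l x), fderiv ℝ (V l) x (b k)⟫ with hS₂
  set S₃ := ∑ l, ∫ x, ⟪convect u (V l) x, (Δ (V l)) x⟫ with hS₃
  calc |-S₁ - S₂ + S₃| ≤ |S₁| + |S₂| + |S₃| := by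
        have e : -S₁ - S₂ + S₃ = -(S₁ + S₂) + S₃ := by ring
        rw [e]
        refine (abs_add_le _ _).trans ?_
        rw [abs_neg]
        exact add_le_add (abs_add_le _ _) le_rfl
    _ ≤ σ₂ * (∫ x, ‖fderiv ℝ v x‖ * ∑ l, ∑ k, ‖fderiv ℝ (V l) x (b k)‖) + σ * H + σ * H :=
        add_le_add (add_le_add hA1 hA2) hB
    _ = 2 * σ * H + σ₂ * ∫ x, ‖fderiv ℝ v x‖ * ∑ l, ∑ k, ‖fderiv ℝ (V l) x (b k)‖ := by ring

end LevelTwoTransport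

end Summit.NavierStokesRegularity.NavierStokesRegularity.Theorems.StrainPairing

end
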